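import Summits.CriticalPhenomena.PercolationContinuityZ3.Theorems.PercNearOneGluingNoHeavyLowerTailSahiBlobReductionStep
import Summits.CriticalPhenomena.PercolationContinuityZ3.Theorems.PercNearOneGluingNoHeavyLowerTailSahiTwoChainUnions
import HarnessLib

/-!
# Two-terminal blob reduction, II: principal cluster moments and Sahi functionals are blob-invariant

Support file for the Sahi programme (`--supports stmt-CriticalPhenomena-4575`, prover prim-sahi-p2 gen 11).  No definitions,
no named facts, no sorries; standard axioms.  Memo `…/prim-sahi-p2/PROOF-E3.md` §22.

**Setting.**  `w : Sym2 V → [0,1]` on a finite vertex type; a finite set `B` of *interior* vertices and two *terminals*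
`u ≠ v` outside `B` such that `w s(x,z) = 0` whenever `x ∈ B` and `z ∉ B ∪ {u,v}` — the pairs meeting `B`, together with
`s(u,v)`, form a two-terminal network (a *blob*) hanging between `u` and `v`.  The *reduced* weight `w'` vanishes on the pairs
meeting `B`, agrees with `w` on all other pairs except `s(u,v)`, and gives `s(u,v)` the probability that the blob network joins
`u` to `v` (under the restriction of `w` to the blob pairs).

**Theorems.**
* `real_principal_blobReduce`: for every root `s ∉ B` and every target set `U` disjoint from `B`,
  `P_w(C_s ⊇ U) = P_{w'}(C_s ⊇ U)`.
* `sahiE_principal_blobReduce`: hence every Sahi functional `E_n` of every family of principal cluster events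
  `{C_s ⊇ T_i}` (root and targets outside `B`) is the same under `bernoulliWeight w` and `bernoulliWeight w'`;
  `sahiE3_incStar_blobReduce`: in particular the increasing star `E₃({s↔a},{s↔b},{s↔c})`.
* `exists_blobReduce`: a reduced weight always exists.

**Consequences** (memo §22).  A minimal counterexample to Sahi positivity of principal cluster events at any order — in
particular to the increasing-star inequality — is *3-connected relative to its marked vertices*: no two vertices separate
off a part containing neither the root nor a target (the series reduction `…SahiSeriesReduction` is the case `|B| = 1`,
two pairs).  Conversely every theorem / certificate on a small marked graph `H` extends to all graphs obtained from `H` by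
replacing pairs by arbitrary finite two-terminal networks (e.g. `SahiPrincipalAntichain.sahiE_principal_fin_four` to every
two-terminal substitution of `K₄` with the four branch vertices marked).

**Proof.**  Induction on the blob (measure: active interior vertices, then non-zero pairs meeting `B`).  Pick a non-zero
pair `e = s(x,z)` meeting `B` (`x ∈ B`); a loop is switched off for free; otherwise `z ∈ B ∪ {u,v}` and the one-bond
decomposition along `e` (tree `prodBernoulli_real_oneBond`) splits `P_w` into the closed branch `w[e↦0]` (fewer non-zero
pairs) and the open branch `w[e↦1]`, which by the tree's weight-one contraction (`KnQ9Contract.real_eq_of_contract`, vertex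
`x` merged into `z`) is a blob weight with fewer active interior vertices (Part I, `…SahiBlobReductionStep`).  Both branches
reduce by induction to weights that agree with `w'` off `s(u,v)`; the blob's two-terminal probability obeys the same
one-bond/contraction identity (`blob_real_openConn_step`), and a final one-bond decomposition along `s(u,v)` — in which all
three reduced weights have the same two branches — closes the induction by affinity in the weight of `s(u,v)`.
-/

noncomputable section

namespace Summit.CriticalPhenomena.PercolationContinuityZ3.Theorems

namespace SahiBlobReduction

open Finset Set unitInterval Literature.Probability.Percolation Literature.Probability.LatticeModels KnQ9Contract
open MeasureTheory Literature.Combinatorics.Sahi2008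
open Literature.Probability.Percolation.DecisionTree (ind ind_of_mem ind_of_not_mem ind_nonneg)
open scoped Classical

variable {V : Type*} [Fintype V]

/-- **Base case**: a weight supported on the single pair `s(u,v)` joins `u ≠ v` with probability `W s(u,v)`. [folklore] -/
private theorem real_openConn_of_single (W : Sym2 V → unitInterval) {u v : V} (huv : u ≠ v)
    (hW : ∀ e, e ≠ s(u, v) → W e = 0) :
    (prodBernoulli W).real (openConn u v) = W s(u, v) := by
  rw [oneBond W s(u, v) (openConn u v)]
  have h1 : (prodBernoulli (Function.update W s(u, v) 1)).real (openConn u v) = 1 := by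
    have hae := prodBernoulli_ae_mem_of_eq_one (Function.update W s(u, v) 1) (i := s(u, v))
      (Function.update_self _ _ _)
    have h0 : prodBernoulli (Function.update W s(u, v) 1) (openConn u v : Set (BondConfig V))ᶜ = 0 := by
      refine measure_eq_zero_iff_ae_notMem.2 ?_
      filter_upwards [hae] with ω hω
      simp only [Set.mem_compl_iff, not_not]
      exact SimpleGraph.Adj.reachable ((openGraph_adj ω u v).2 ⟨hω, huv⟩)
    rw [measureReal_congr (ae_eq_univ.2 h0), probReal_univ]
  have h0 : (prodBernoulli (Function.update W s(u, v) 0)).real (openConn u v) = 0 := by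
    have hzero : ∀ e ∈ (Set.univ : Set (Sym2 V)), Function.update W s(u, v) 0 e = 0 := by
      intro e _
      by_cases he : e = s(u, v)
      · subst he; exact Function.update_self _ _ _
      · rw [Function.update_of_ne he]; exact hW e he
    have hae := prodBernoulli_ae_forall_notMem (Function.update W s(u, v) 0) Set.countable_univ hzero
    have hμ : prodBernoulli (Function.update W s(u, v) 0) (openConn u v : Set (BondConfig V)) = 0 := by
      refine measure_eq_zero_iff_ae_notMem.2 ?_
      filter_upwards [hae] with ω hω
      intro hreach
      have hempty : ω = ∅ := Set.eq_empty_iff_forall_notMem.2 fun e he => hω e (Set.mem_univ e) he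
      subst hempty
      have : (openGraph (∅ : BondConfig V)) = ⊥ := by
        unfold openGraph; exact SimpleGraph.fromEdgeSet_empty
      rw [openConn, Set.mem_setOf_eq, this, SimpleGraph.reachable_bot] at hreach
      exact huv hreach
    rw [measureReal_def, hμ, ENNReal.toReal_zero]
  rw [h1, h0]
  ring

/-- **Core of the blob reduction** (induction on the blob).  For every blob weight `W` for `(B, u, v)` and every weight
`W'` that vanishes on the pairs meeting `B`, agrees with `W` off the blob pairs, and gives `s(u,v)` the two-terminal
connection probability of the blob, all principal cluster events with root and targets outside `B` have the same
probability under `W` and `W'`.  (`M` is an induction measure: active interior vertices and non-zero blob pairs.) [this work] -/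
theorem real_principal_blobReduce_core (B : Finset V) {u v : V} (hu : u ∉ B) (hv : v ∉ B) (huv : u ≠ v) (M : ℕ) :
    ∀ (W W' : Sym2 V → unitInterval),
      (B.filter fun y => ∃ z', W s(y, z') ≠ 0).card * (Fintype.card (Sym2 V) + 1) +
          (Finset.univ.filter fun e : Sym2 V => (∃ x ∈ B, x ∈ e) ∧ W e ≠ 0).card = M →
      (∀ x ∈ B, ∀ z, z ∉ B → z ≠ u → z ≠ v → W s(x, z) = 0) →
      (∀ x ∈ B, ∀ z, W' s(x, z) = 0) →
      (∀ e, (∀ x ∈ B, x ∉ e) → e ≠ s(u, v) → W' e = W e) →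
      ((W' s(u, v) : ℝ) = (prodBernoulli (fun e' => if (∃ x' ∈ B, x' ∈ e') ∨ e' = s(u, v) then W e' else 0)).real
          (openConn u v)) →
      ∀ s, s ∉ B → ∀ U : Finset V, (∀ t ∈ U, t ∉ B) →
        (prodBernoulli W).real (⋂ t ∈ U, (openConn s t : Set (BondConfig V))) =
          (prodBernoulli W').real (⋂ t ∈ U, (openConn s t : Set (BondConfig V))) := by
  induction M using Nat.strong_induction_on with
  | _ M IH =>
  intro W W' hM hWblob hW'B hW'off hW'uv s hs U hU
  by_cases hempty : (Finset.univ.filter fun e : Sym2 V => (∃ x ∈ B, x ∈ e) ∧ W e ≠ 0) = ∅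
  · -- BASE: no non-zero pair meets `B`; then `W' = W`
    have hWB : ∀ e, (∃ x ∈ B, x ∈ e) → W e = 0 := by
      intro e he
      by_contra hne
      have : e ∈ (Finset.univ.filter fun e : Sym2 V => (∃ x ∈ B, x ∈ e) ∧ W e ≠ 0) :=
        Finset.mem_filter.2 ⟨Finset.mem_univ _, he, hne⟩
      rw [hempty] at this
      exact Finset.notMem_empty _ this
    have hρ : (prodBernoulli (fun e' => if (∃ x' ∈ B, x' ∈ e') ∨ e' = s(u, v) then W e' else 0)).real
        (openConn u v) = W s(u, v) := by
      rw [real_openConn_of_single _ huv (fun e hne => ?_)]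
      · simp
      by_cases he : (∃ x ∈ B, x ∈ e) ∨ e = s(u, v)
      · rw [if_pos he]
        rcases he with he | he
        · exact hWB e he
        · exact absurd he hne
      · rw [if_neg he]
    have hW'W : W' = W := by
      funext e
      by_cases he : ∃ x ∈ B, x ∈ e
      · obtain ⟨x, hxB, hxe⟩ := he
        obtain ⟨z, rfl⟩ := exists_eq_mk_of_mem hxe
        rw [hW'B x hxB z, hWB _ ⟨x, hxB, hxe⟩]
      · by_cases heuv : e = s(u, v)
        · subst heuv
          exact Subtype.ext (hW'uv.trans hρ)
        · push Not at he
          exact hW'off e he heuv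
    rw [hW'W]
  -- STEP: pick a non-zero pair `e = s(x, z)` meeting `B`
  obtain ⟨e, he⟩ := Finset.nonempty_of_ne_empty hempty
  obtain ⟨-, ⟨x, hxB, hxe⟩, hWe⟩ := Finset.mem_filter.1 he
  obtain ⟨z, rfl⟩ := exists_eq_mk_of_mem hxe
  have hsx : s ≠ x := fun h => hs (h ▸ hxB)
  have hxU : x ∉ U := fun h => hU x h hxB
  have hblob_e : (∃ x' ∈ B, x' ∈ s(x, z)) ∨ s(x, z) = s(u, v) := Or.inl ⟨x, hxB, hxe⟩
  -- counting: switching `e` off lowers the measure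
  have hmeas0 : (B.filter fun y => ∃ z', Function.update W s(x, z) 0 s(y, z') ≠ 0).card *
        (Fintype.card (Sym2 V) + 1) +
      (Finset.univ.filter fun e : Sym2 V => (∃ x ∈ B, x ∈ e) ∧ Function.update W s(x, z) 0 e ≠ 0).card < M := by
    have h1 : (B.filter fun y => ∃ z', Function.update W s(x, z) 0 s(y, z') ≠ 0).card ≤
        (B.filter fun y => ∃ z', W s(y, z') ≠ 0).card := by
      refine Finset.card_le_card fun y hy => ?_
      obtain ⟨hyB, z', hz'⟩ := Finset.mem_filter.1 hy
      refine Finset.mem_filter.2 ⟨hyB, z', fun h0 => hz' ?_⟩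
      by_cases heq : s(y, z') = s(x, z)
      · rw [heq, Function.update_self]
      · rw [Function.update_of_ne heq, h0]
    have h2 : (Finset.univ.filter fun e : Sym2 V => (∃ x ∈ B, x ∈ e) ∧ Function.update W s(x, z) 0 e ≠ 0).card
        < (Finset.univ.filter fun e : Sym2 V => (∃ x ∈ B, x ∈ e) ∧ W e ≠ 0).card := by
      refine Finset.card_lt_card ((Finset.ssubset_iff_of_subset fun e' he' => ?_).2 ⟨s(x, z), he, fun h => ?_⟩)
      · obtain ⟨-, hB', hne⟩ := Finset.mem_filter.1 he'
        refine Finset.mem_filter.2 ⟨Finset.mem_univ _, hB', fun h0 => hne ?_⟩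
        by_cases heq : e' = s(x, z)
        · rw [heq, Function.update_self]
        · rw [Function.update_of_ne heq, h0]
      · exact (Finset.mem_filter.1 h).2.2 (Function.update_self _ _ _)
    rw [← hM]
    exact Nat.add_lt_add_of_le_of_lt (Nat.mul_le_mul_right _ h1) h2
  by_cases hzx : z = x
  · -- LOOP at `x`: switch it off, nothing changes
    subst hzx
    have hdiag : (s(z, z) : Sym2 V).IsDiag := by rw [Sym2.mk_isDiag_iff]
    rw [← real_update_diag W hdiag 0 (determinedBy_principal_offDiag s U)]
    refine IH _ hmeas0 (Function.update W s(z, z) 0) W' rfl (fun x' hx' z' hz'B hz'u hz'v => ?_) hW'B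
      (fun e' he'B he'uv => ?_) ?_ s hs U hU
    · by_cases heq : s(x', z') = s(z, z)
      · rw [heq, Function.update_self]
      · rw [Function.update_of_ne heq]; exact hWblob x' hx' z' hz'B hz'u hz'v
    · rw [hW'off e' he'B he'uv, update_of_not_mem W 0 (he'B z hxB)]
    · rw [hW'uv, blobRestrict_update W hblob_e 0,
        real_update_diag _ hdiag 0 (determinedBy_openConn_offDiag u v)]
  -- GENUINE pair `e = s(x, z)`, `z ≠ x`, `z ∈ B ∪ {u, v}`
  have hz : z ∈ B ∨ z = u ∨ z = v := by
    by_contra h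
    push Not at h
    exact hWe (hWblob x hxB z h.1 h.2.1 h.2.2)
  have hzx' : z ≠ x := hzx
  -- the two analytic inputs, stated before the abbreviations are introduced
  have hρ := blob_real_openConn_step W hu hv hxB hz hzx' hWblob
  have hopen := real_principal_contract W hzx' hsx hxU (U := U)
  have hmeasc_raw : (B.filter fun y => ∃ z', cweight z x (Function.update W s(x, z) 1) s(y, z') ≠ 0).card <
      (B.filter fun y => ∃ z', W s(y, z') ≠ 0).card := by
    refine Finset.card_lt_card ((Finset.ssubset_iff_of_subset fun y hy => ?_).2 ⟨x, ?_, fun h => ?_⟩)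
    · obtain ⟨hyB, z', hz'⟩ := Finset.mem_filter.1 hy
      obtain ⟨-, z'', hz''⟩ := cweight_active W hzx' z' hz' hWe
      exact Finset.mem_filter.2 ⟨hyB, z'', hz''⟩
    · exact Finset.mem_filter.2 ⟨hxB, z, hWe⟩
    · obtain ⟨-, z', hz'⟩ := Finset.mem_filter.1 h
      exact (cweight_active W hzx' z' hz' hWe).1 rfl
  have hWcblob := cweight_blob W hxB hz hzx' hWblob
  have hWcoff := cweight_off_blob W hu hv hxB hz hzx' hWblob
  -- abbreviations
  set W₀ : Sym2 V → unitInterval := Function.update W s(x, z) 0 with hW₀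
  set Wc : Sym2 V → unitInterval := cweight z x (Function.update W s(x, z) 1) with hWc
  obtain ⟨ρ₀, hρ₀⟩ : ∃ r : ℝ, (prodBernoulli (fun e' => if (∃ x' ∈ B, x' ∈ e') ∨ e' = s(u, v) then
      W₀ e' else 0)).real (openConn u v) = r := ⟨_, rfl⟩
  obtain ⟨ρc, hρc⟩ : ∃ r : ℝ, (prodBernoulli (fun e' => if (∃ x' ∈ B, x' ∈ e') ∨ e' = s(u, v) then
      Wc e' else 0)).real (openConn u v) = r := ⟨_, rfl⟩
  have h0ρ₀ : 0 ≤ ρ₀ := hρ₀ ▸ measureReal_nonneg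
  have h1ρ₀ : ρ₀ ≤ 1 := hρ₀ ▸ measureReal_le_one
  have h0ρc : 0 ≤ ρc := hρc ▸ measureReal_nonneg
  have h1ρc : ρc ≤ 1 := hρc ▸ measureReal_le_one
  rw [hρ₀, hρc] at hρ
  set W₀' : Sym2 V → unitInterval := Function.update W' s(u, v) ⟨ρ₀, h0ρ₀, h1ρ₀⟩ with hW₀'
  set Wc' : Sym2 V → unitInterval := Function.update W' s(u, v) ⟨ρc, h0ρc, h1ρc⟩ with hWc'
  -- reduced-weight hypotheses for the two branches
  have hred_B : ∀ (r : unitInterval), ∀ x' ∈ B, ∀ z', Function.update W' s(u, v) r s(x', z') = 0 := by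
    intro r x' hx' z'
    rw [Function.update_of_ne (mk_ne_terminal hu hv hx' z')]
    exact hW'B x' hx' z'
  -- IH, closed branch
  have IH₀ : (prodBernoulli W₀).real (⋂ t ∈ U, (openConn s t : Set (BondConfig V))) =
      (prodBernoulli W₀').real (⋂ t ∈ U, (openConn s t : Set (BondConfig V))) := by
    refine IH _ hmeas0 W₀ W₀' rfl (fun x' hx' z' hz'B hz'u hz'v => ?_) (hred_B _)
      (fun e' he'B he'uv => ?_) ?_ s hs U hU
    · by_cases heq : s(x', z') = s(x, z)
      · rw [hW₀, heq, Function.update_self]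
      · rw [hW₀, Function.update_of_ne heq]; exact hWblob x' hx' z' hz'B hz'u hz'v
    · rw [hW₀', Function.update_of_ne he'uv, hW'off e' he'B he'uv, hW₀, update_of_not_mem W 0 (he'B x hxB)]
    · rw [hW₀', Function.update_self, hρ₀]
  -- IH, open branch (after contraction)
  have hmeasc : (B.filter fun y => ∃ z', Wc s(y, z') ≠ 0).card * (Fintype.card (Sym2 V) + 1) +
      (Finset.univ.filter fun e : Sym2 V => (∃ x ∈ B, x ∈ e) ∧ Wc e ≠ 0).card < M := by
    have h2 : (Finset.univ.filter fun e : Sym2 V => (∃ x ∈ B, x ∈ e) ∧ Wc e ≠ 0).card ≤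
        Fintype.card (Sym2 V) := Finset.card_le_univ _
    rw [← hM]
    calc (B.filter fun y => ∃ z', Wc s(y, z') ≠ 0).card * (Fintype.card (Sym2 V) + 1) +
          (Finset.univ.filter fun e : Sym2 V => (∃ x ∈ B, x ∈ e) ∧ Wc e ≠ 0).card
        < (B.filter fun y => ∃ z', Wc s(y, z') ≠ 0).card * (Fintype.card (Sym2 V) + 1) +
          (Fintype.card (Sym2 V) + 1) := by omega
      _ = ((B.filter fun y => ∃ z', Wc s(y, z') ≠ 0).card + 1) * (Fintype.card (Sym2 V) + 1) := by ring
      _ ≤ (B.filter fun y => ∃ z', W s(y, z') ≠ 0).card * (Fintype.card (Sym2 V) + 1) :=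
          Nat.mul_le_mul_right _ hmeasc_raw
      _ ≤ (B.filter fun y => ∃ z', W s(y, z') ≠ 0).card * (Fintype.card (Sym2 V) + 1) +
          (Finset.univ.filter fun e : Sym2 V => (∃ x ∈ B, x ∈ e) ∧ W e ≠ 0).card := Nat.le_add_right _ _
  have IHc : (prodBernoulli Wc).real (⋂ t ∈ U, (openConn s t : Set (BondConfig V))) =
      (prodBernoulli Wc').real (⋂ t ∈ U, (openConn s t : Set (BondConfig V))) := by
    refine IH _ hmeasc Wc Wc' rfl hWcblob (hred_B _) (fun e' he'B he'uv => ?_) ?_ s hs U hU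
    · rw [hWc', Function.update_of_ne he'uv, hW'off e' he'B he'uv]
      exact (hWcoff e' he'B he'uv).symm
    · rw [hWc', Function.update_self, hρc]
  -- assemble: one bond along `e` for `W`, one bond along `s(u,v)` for the three reduced weights
  have hX0 : ∀ c, Function.update W₀' s(u, v) c = Function.update W' s(u, v) c := fun c => by
    rw [hW₀', Function.update_idem]
  have hXc : ∀ c, Function.update Wc' s(u, v) c = Function.update W' s(u, v) c := fun c => by
    rw [hWc', Function.update_idem]
  have hv0 : (W₀' s(u, v) : ℝ) = ρ₀ := by rw [hW₀', Function.update_self]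
  have hvc : (Wc' s(u, v) : ℝ) = ρc := by rw [hWc', Function.update_self]
  rw [oneBond W s(x, z), hopen, IH₀, IHc, oneBond W₀' s(u, v), oneBond Wc' s(u, v),
    oneBond W' s(u, v), hX0, hX0, hXc, hXc, hv0, hvc, hW'uv, hρ]
  ring

/-! ### User-facing forms -/

/-- **Two-terminal blob reduction preserves the probability of every principal cluster event** `{C_s ⊇ U}` with root and
targets outside the blob interior `B`.  Here `w` is any weight for which the pairs from `B` to the outside of `B ∪ {u,v}`
vanish, and `w'` is any weight vanishing on the pairs meeting `B`, equal to `w` on the other pairs except `s(u,v)`, where it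
carries the probability that the blob network (the pairs meeting `B`, plus `s(u,v)`) joins `u` to `v`. [this work] -/
theorem real_principal_blobReduce (w w' : Sym2 V → unitInterval) (B : Finset V) {u v s : V}
    (hu : u ∉ B) (hv : v ∉ B) (huv : u ≠ v) (hs : s ∉ B)
    (hw : ∀ x ∈ B, ∀ z, z ∉ B → z ≠ u → z ≠ v → w s(x, z) = 0)
    (hw'B : ∀ x ∈ B, ∀ z, w' s(x, z) = 0)
    (hw'off : ∀ e, (∀ x ∈ B, x ∉ e) → e ≠ s(u, v) → w' e = w e)
    (hw'uv : (w' s(u, v) : ℝ) =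
      (prodBernoulli (fun e' => if (∃ x' ∈ B, x' ∈ e') ∨ e' = s(u, v) then w e' else 0)).real (openConn u v))
    (U : Finset V) (hU : ∀ t ∈ U, t ∉ B) :
    (prodBernoulli w).real (⋂ t ∈ U, (openConn s t : Set (BondConfig V))) =
      (prodBernoulli w').real (⋂ t ∈ U, (openConn s t : Set (BondConfig V))) :=
  real_principal_blobReduce_core B hu hv huv _ w w' rfl hw hw'B hw'off hw'uv s hs U hU

omit [Fintype V] in
/-- Products of indicators are indicators of intersections (plumbing). [folklore] -/
private theorem prod_ind_eq_ind_biInter {α ι : Type*} (S : Finset ι) (A : ι → Set α) :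
    ∏ i ∈ S, ind (A i) = ind (⋂ i ∈ S, A i) := by
  classical
  induction S using Finset.induction_on with
  | empty => funext a; simp [ind_of_mem]
  | insert a S ha ih =>
    rw [Finset.prod_insert ha, ih]
    funext z
    rw [Pi.mul_apply, ← BHK2006.ind_inter]
    congr 1
    ext z'
    simp

/-- **Two-terminal blob reduction preserves every Sahi functional `E_n` of principal cluster events** (root and targets
outside the blob interior).  Consequently a minimal counterexample to Sahi positivity of principal cluster events — in
particular to the increasing-star inequality — has no two-vertex separation `{u, v}` cutting off a piece without root or
targets: it is 3-connected relative to the marked vertices, and every small-graph theorem or certificate of the programme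
applies to all graphs obtained by substituting arbitrary finite two-terminal networks for edges. [this work] -/
theorem sahiE_principal_blobReduce (w w' : Sym2 V → unitInterval) (B : Finset V) {u v s : V}
    (hu : u ∉ B) (hv : v ∉ B) (huv : u ≠ v) (hs : s ∉ B)
    (hw : ∀ x ∈ B, ∀ z, z ∉ B → z ≠ u → z ≠ v → w s(x, z) = 0)
    (hw'B : ∀ x ∈ B, ∀ z, w' s(x, z) = 0)
    (hw'off : ∀ e, (∀ x ∈ B, x ∉ e) → e ≠ s(u, v) → w' e = w e)
    (hw'uv : (w' s(u, v) : ℝ) =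
      (prodBernoulli (fun e' => if (∃ x' ∈ B, x' ∈ e') ∨ e' = s(u, v) then w e' else 0)).real (openConn u v))
    (n : ℕ) (T : Fin n → Finset V) (hT : ∀ i, ∀ t ∈ T i, t ∉ B) :
    sahiE (bernoulliWeight w) n (fun i => ind (⋂ t ∈ T i, (openConn s t : Set (BondConfig V)))) =
      sahiE (bernoulliWeight w') n (fun i => ind (⋂ t ∈ T i, (openConn s t : Set (BondConfig V)))) := by
  refine TwoChainUnions.sahiE_congr_of_prodMoments _ _ n _ _ fun S => ?_
  have hset : (⋂ i ∈ S, ⋂ t ∈ T i, (openConn s t : Set (BondConfig V))) =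
      ⋂ t ∈ S.biUnion T, (openConn s t : Set (BondConfig V)) := by
    ext ω
    simp only [Set.mem_iInter, Finset.mem_biUnion]
    constructor
    · rintro h t ⟨i, hi, ht⟩
      exact h i hi t ht
    · intro h i hi t ht
      exact h t ⟨i, hi, ht⟩
  rw [prod_ind_eq_ind_biInter, ex_bernoulliWeight_ind, ex_bernoulliWeight_ind, hset]
  refine real_principal_blobReduce w w' B hu hv huv hs hw hw'B hw'off hw'uv (S.biUnion T) fun t ht => ?_
  obtain ⟨i, -, hi⟩ := Finset.mem_biUnion.1 ht
  exact hT i t hi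

/-- **The increasing star is invariant under two-terminal blob substitution**: for root and targets outside the blob
interior, `E₃({s↔a},{s↔b},{s↔c})` is the same for `w` and for the reduced weight `w'`. [this work] -/
theorem sahiE3_incStar_blobReduce (w w' : Sym2 V → unitInterval) (B : Finset V) {u v s : V}
    (hu : u ∉ B) (hv : v ∉ B) (huv : u ≠ v) (hs : s ∉ B)
    (hw : ∀ x ∈ B, ∀ z, z ∉ B → z ≠ u → z ≠ v → w s(x, z) = 0)
    (hw'B : ∀ x ∈ B, ∀ z, w' s(x, z) = 0)
    (hw'off : ∀ e, (∀ x ∈ B, x ∉ e) → e ≠ s(u, v) → w' e = w e)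
    (hw'uv : (w' s(u, v) : ℝ) =
      (prodBernoulli (fun e' => if (∃ x' ∈ B, x' ∈ e') ∨ e' = s(u, v) then w e' else 0)).real (openConn u v))
    {a b c : V} (ha : a ∉ B) (hb : b ∉ B) (hc : c ∉ B) :
    sahiE3 (prodBernoulli w) (openConn s a) (openConn s b) (openConn s c) =
      sahiE3 (prodBernoulli w') (openConn s a) (openConn s b) (openConn s c) := by
  have h := sahiE_principal_blobReduce w w' B hu hv huv hs hw hw'B hw'off hw'uv 3 ![{a}, {b}, {c}]
    (fun i => by fin_cases i <;> simpa)
  have hf : (fun i : Fin 3 => ind (⋂ t ∈ (![{a}, {b}, {c}] : Fin 3 → Finset V) i,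
      (openConn s t : Set (BondConfig V)))) = ![ind (openConn s a), ind (openConn s b), ind (openConn s c)] := by
    funext i; fin_cases i <;> simp
  rw [hf] at h
  rw [← sahiE_three_ind, ← sahiE_three_ind]
  exact h

/-- **Existence form.**  Every blob weight admits a reduced weight: supported off the blob interior, equal to `w` off the
blob pairs, and with the same Sahi functionals of every order for all principal cluster families with root and targets
outside the blob. [this work] -/
theorem exists_blobReduce (w : Sym2 V → unitInterval) (B : Finset V) {u v : V} (hu : u ∉ B) (hv : v ∉ B) (huv : u ≠ v)
    (hw : ∀ x ∈ B, ∀ z, z ∉ B → z ≠ u → z ≠ v → w s(x, z) = 0) :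
    ∃ w' : Sym2 V → unitInterval,
      (∀ x ∈ B, ∀ z, w' s(x, z) = 0) ∧ (∀ e, (∀ x ∈ B, x ∉ e) → e ≠ s(u, v) → w' e = w e) ∧
      ((w' s(u, v) : ℝ) =
        (prodBernoulli (fun e' => if (∃ x' ∈ B, x' ∈ e') ∨ e' = s(u, v) then w e' else 0)).real (openConn u v)) ∧
      ∀ s, s ∉ B → ∀ (n : ℕ) (T : Fin n → Finset V), (∀ i, ∀ t ∈ T i, t ∉ B) →
        sahiE (bernoulliWeight w) n (fun i => ind (⋂ t ∈ T i, (openConn s t : Set (BondConfig V)))) =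
          sahiE (bernoulliWeight w') n (fun i => ind (⋂ t ∈ T i, (openConn s t : Set (BondConfig V)))) := by
  obtain ⟨ρ, hρ⟩ : ∃ r : ℝ, (prodBernoulli (fun e' => if (∃ x' ∈ B, x' ∈ e') ∨ e' = s(u, v) then w e' else 0)).real
      (openConn u v) = r := ⟨_, rfl⟩
  have h0 : 0 ≤ ρ := hρ ▸ measureReal_nonneg
  have h1 : ρ ≤ 1 := hρ ▸ measureReal_le_one
  obtain ⟨w', hw'def⟩ : ∃ w' : Sym2 V → unitInterval,
      ∀ e, w' e = if ∃ x ∈ B, x ∈ e then 0 else if e = s(u, v) then ⟨ρ, h0, h1⟩ else w e := ⟨_, fun e => rfl⟩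
  have hw'B : ∀ x ∈ B, ∀ z, w' s(x, z) = 0 := fun x hx z => by
    rw [hw'def, if_pos ⟨x, hx, Sym2.mem_mk_left x z⟩]
  have hw'off : ∀ e, (∀ x ∈ B, x ∉ e) → e ≠ s(u, v) → w' e = w e := fun e heB heuv => by
    rw [hw'def, if_neg (by push Not; exact heB), if_neg heuv]
  have hw'uv : (w' s(u, v) : ℝ) = (prodBernoulli (fun e' => if (∃ x' ∈ B, x' ∈ e') ∨ e' = s(u, v) then
      w e' else 0)).real (openConn u v) := by
    have hnot : ¬ ∃ x ∈ B, x ∈ s(u, v) := by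
      rintro ⟨x, hx, hxe⟩
      rcases Sym2.mem_iff.1 hxe with rfl | rfl
      · exact hu hx
      · exact hv hx
    rw [hw'def, if_neg hnot, if_pos rfl, hρ]
  exact ⟨w', hw'B, hw'off, hw'uv, fun s hs n T hT =>
    sahiE_principal_blobReduce w w' B hu hv huv hs hw hw'B hw'off hw'uv n T hT⟩


end SahiBlobReduction

end Summit.CriticalPhenomena.PercolationContinuityZ3.Theorems
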